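import Mathlib
import HarnessLib
import Summits.NavierStokesRegularity.NavierStokesRegularity.Theorems.PoloidalWindowRigidity.Negative.TriSheetGenericity

/-!
# Crux `PoloidalWindowRigidity` (K2, stmt-NavierStokesRegularity-19708) — negative side:
# the TIME-DERIVATIVE class rate removes the log-drifted witnesses

Negative-side support (refuter seat ns-regularity-refuter1 gen 2; D-0081 §C), sequel of
`…Negative.TriSheetGenericity`.

`…Theorems.PoloidalWindowDoorPoloidalWindowRigidityClassSpaceTimeRates.exists_deriv_rate_of_class` (nsreg-p7 g7,
p503432) proves for the Type-I mild class the time-derivative rate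
«(T) `∃ K ≥ 0, ∀ t < 0, ∀ y, ‖∂_τ v(τ, y)|_{τ=t}‖ ≤ K/((−t)√(−t))`» — an (M)-consequence the residue stub may carry
as a hypothesis.  This file certifies that (T) BITES the three-sheet witness `sheetProfile` (and, by the same
mechanism, every log-drifted profile `c_t U(c_t x + log(−t)e₁)` of this lane): at the point
`y_t = −√(−t)·log(−t)·e₁`, which the drift carries to the similarity origin, the vertical component of `∂_t v` is
`−(2 log(−t) + 4)/((−t)√(−t))` — the self-similar stretching term `c′_t x·∇` acts at similarity distance
`|log(−t)|` from the axis, so the rate is violated by the factor `log(−t)` (`t = −e^K` defeats the constant `K`).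
Lemmas: the time derivatives of `cellAmp`, `log(−·)`, `driftShift`, `sheetProfile` at every `t < 0`.

Reading for the lead: in similarity variables `v(t,x) = c_t U(c_t x, log(−t))` the clause (T) reads
`‖U + ξ·∇_ξ U − 2 ∂_σ U‖ ≤ 2K`; the log drift `U = S(ξ + σ e₁)` violates it linearly in `σ`, the periodic cellular /
three-wave profiles violate it linearly in `ξ` even without drift, while a localized `S` (bounded `ξ·∇S`) modulated
periodically in `σ` passes.  So (T) is orthogonal to the thin-energy clause (ix) (`…Negative.TriSheetEnergy`): it
removes the drift mechanism of this lane at every energy growth exponent.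

WHAT THIS IS NOT: not a claim about Navier–Stokes and not a refutation of any registered stub; kinematics of an
explicit non-mild profile. [folklore]
-/

noncomputable section

-- the summit and its single sub-problem share the name (CONVENTIONS §1), as in every Theorems file
set_option linter.dupNamespace false

namespace Summit.NavierStokesRegularity.NavierStokesRegularity.Theorems.PoloidalWindowRigidity.Negative

open MeasureTheory Set Function Filter Topology Metric
open scoped RealInnerProductSpace InnerProductSpace ENNReal NNReal
open Literature.Analysis Literature.Analysis.FluidPDE

/-! ## Time derivatives of the similarity data -/

/-- `c_t³ = 1/((−t)√(−t))`. [folklore] -/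
theorem cellAmp_pow_three {t : ℝ} (ht : t < 0) : cellAmp t ^ 3 = ((-t) * Real.sqrt (-t))⁻¹ := by
  rw [pow_succ, cellAmp_sq ht, cellAmp, mul_inv]

/-- `d/dt c_t = c_t³/2` for `t < 0`. [folklore] -/
theorem hasDerivAt_cellAmp {t : ℝ} (ht : t < 0) : HasDerivAt cellAmp (cellAmp t ^ 3 / 2) t := by
  have hs : 0 < Real.sqrt (-t) := Real.sqrt_pos.2 (by linarith)
  have h1 : HasDerivAt (fun τ : ℝ => -τ) (-1) t := hasDerivAt_neg' t
  have h2 : HasDerivAt (fun τ : ℝ => Real.sqrt (-τ)) (1 / (2 * Real.sqrt (-t)) * (-1)) t :=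
    (Real.hasDerivAt_sqrt (by linarith : -t ≠ 0)).comp t h1
  have h3 : HasDerivAt cellAmp (-(1 / (2 * Real.sqrt (-t)) * (-1)) / Real.sqrt (-t) ^ 2) t := h2.inv hs.ne'
  refine h3.congr_deriv ?_
  rw [cellAmp]
  field_simp

/-- `d/dt log(−t) = −c_t²` for `t < 0`. [folklore] -/
theorem hasDerivAt_log_neg {t : ℝ} (ht : t < 0) :
    HasDerivAt (fun τ : ℝ => Real.log (-τ)) (-(cellAmp t ^ 2)) t := by
  have h1 : HasDerivAt (fun τ : ℝ => -τ) (-1) t := hasDerivAt_neg' t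
  have h2 : HasDerivAt (fun τ : ℝ => Real.log (-τ)) ((-t)⁻¹ * (-1)) t :=
    (Real.hasDerivAt_log (by linarith : -t ≠ 0)).comp t h1
  refine h2.congr_deriv ?_
  rw [cellAmp_sq ht]
  ring

/-- Time derivative of the drifted similarity variable `ξ(t) = c_t y + log(−t) e₁`. [folklore] -/
theorem hasDerivAt_driftShift {t : ℝ} (ht : t < 0) (y : EuclideanSpace ℝ (Fin 3)) :
    HasDerivAt (fun τ => driftShift τ y)
      ((cellAmp t ^ 3 / 2) • y + (-(cellAmp t ^ 2)) • EuclideanSpace.single (1 : Fin 3) (1 : ℝ)) t := by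
  show HasDerivAt (fun τ => cellAmp τ • y + Real.log (-τ) • EuclideanSpace.single (1 : Fin 3) (1 : ℝ)) _ t
  exact ((hasDerivAt_cellAmp ht).smul_const y).add ((hasDerivAt_log_neg ht).smul_const _)

/-- **Time derivative of the three-sheet profile** at every `t < 0`, `y`:
`∂_t v = c_t DS(ξ) ξ′ + (c_t³/2) S(ξ)`, `ξ = c_t y + log(−t)e₁`, `ξ′ = (c_t³/2) y − c_t² e₁`. [folklore] -/
theorem hasDerivAt_sheetProfile_time {t : ℝ} (ht : t < 0) (y : EuclideanSpace ℝ (Fin 3)) :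
    HasDerivAt (fun τ => sheetProfile τ y)
      (cellAmp t • sheetDeriv (driftShift t y)
          ((cellAmp t ^ 3 / 2) • y + (-(cellAmp t ^ 2)) • EuclideanSpace.single (1 : Fin 3) (1 : ℝ)) +
        (cellAmp t ^ 3 / 2) • sheetField (driftShift t y)) t := by
  have hξ := hasDerivAt_driftShift ht y
  have hS := (hasFDerivAt_sheetField (driftShift t y)).comp_hasDerivAt t hξ
  exact (hasDerivAt_cellAmp ht).smul hS

/-! ## The rate is violated by the factor `log(−t)` -/

/-- **The time-derivative class rate FAILS for the three-sheet profile, for every constant**: at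
`t = −e^K` and `y = −√(−t) log(−t) e₁` the vertical component of `∂_t v` is `−(2K + 4)/((−t)√(−t))`.
[folklore] -/
theorem sheetProfile_timeDeriv_exceeds (K : ℝ) :
    ∃ t < 0, ∃ y : EuclideanSpace ℝ (Fin 3),
      K / ((-t) * Real.sqrt (-t)) < ‖deriv (fun τ => sheetProfile τ y) t‖ := by
  set t : ℝ := -Real.exp K with ht_def
  have ht : t < 0 := by
    have := Real.exp_pos K
    linarith
  have hlog : Real.log (-t) = K := by rw [ht_def, neg_neg, Real.log_exp]
  have hc : 0 < cellAmp t := cellAmp_pos ht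
  set b : ℝ := -K / cellAmp t with hb
  have hcb : cellAmp t * b = -K := by
    rw [hb]
    field_simp
  set y : EuclideanSpace ℝ (Fin 3) := b • EuclideanSpace.single (1 : Fin 3) (1 : ℝ) with hy
  refine ⟨t, ht, y, ?_⟩
  -- the drift carries `y` to the similarity origin
  have hξ : driftShift t y = 0 := by
    ext i
    fin_cases i
    · simp [driftShift_apply_zero, hy, PiLp.smul_apply]
    · simp [driftShift_apply_one, hy, PiLp.smul_apply, hlog, hcb]
    · simp [driftShift_apply_two, hy, PiLp.smul_apply]
  have hF := hasDerivAt_sheetProfile_time ht y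
  rw [hF.deriv, hξ, sheetField_zero, smul_zero, add_zero]
  -- the vertical component of the derivative
  set w : EuclideanSpace ℝ (Fin 3) :=
    (cellAmp t ^ 3 / 2) • y + (-(cellAmp t ^ 2)) • EuclideanSpace.single (1 : Fin 3) (1 : ℝ) with hw
  have hw0 : w 0 = 0 := by simp [hw, hy, PiLp.smul_apply]
  have hw2 : w 2 = 0 := by simp [hw, hy, PiLp.smul_apply]
  have hw1 : w 1 = cellAmp t ^ 3 / 2 * b - cellAmp t ^ 2 := by
    simp [hw, hy, PiLp.smul_apply]
    ring
  have h2 : (cellAmp t • sheetDeriv 0 w) 2 = -(cellAmp t ^ 3 * (2 * K + 4)) := by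
    rw [PiLp.smul_apply, smul_eq_mul, sheetDeriv_apply_two, hw0, hw2, hw1]
    simp only [PiLp.zero_apply, add_zero, sub_zero, oddBumpDeriv_zero]
    have : cellAmp t ^ 4 * b = cellAmp t ^ 3 * (cellAmp t * b) := by ring
    linear_combination (2 : ℝ) * this + (2 : ℝ) * cellAmp t ^ 3 * hcb
  have hc3 : 0 < cellAmp t ^ 3 := by positivity
  have hnorm : cellAmp t ^ 3 * (2 * K + 4) ≤ ‖cellAmp t • sheetDeriv 0 w‖ := by
    have h := PiLp.norm_apply_le (cellAmp t • sheetDeriv 0 w) 2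
    rw [h2, Real.norm_eq_abs, abs_neg] at h
    exact (le_abs_self _).trans h
  rw [div_eq_mul_inv, ← cellAmp_pow_three ht]
  -- `K c³ < c³ (2K+4)` whatever the sign of `K`
  rcases le_or_gt 0 (2 * K + 4) with hpos | hneg
  · calc K * cellAmp t ^ 3 < cellAmp t ^ 3 * (2 * K + 4) := by nlinarith
      _ ≤ _ := hnorm
  · calc K * cellAmp t ^ 3 < 0 := by nlinarith
      _ ≤ _ := norm_nonneg _

/-- **Clause (T) (the time-derivative class rate, in the shape of `exists_deriv_rate_of_class`) is FALSE for the
three-sheet profile.** So (T) removes this (M)-free witness — and every log-drifted one. [folklore] -/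
theorem sheetProfile_not_timeDerivRate :
    ¬ ∃ K : ℝ, 0 ≤ K ∧ ∀ t < 0, ∀ y : EuclideanSpace ℝ (Fin 3),
        ‖deriv (fun τ => sheetProfile τ y) t‖ ≤ K / ((-t) * Real.sqrt (-t)) := by
  rintro ⟨K, -, hK⟩
  obtain ⟨t, ht, y, hlt⟩ := sheetProfile_timeDeriv_exceeds K
  exact absurd (hK t ht y) (not_le.2 hlt)

end Summit.NavierStokesRegularity.NavierStokesRegularity.Theorems.PoloidalWindowRigidity.Negative

end
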